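import Summits.Ventures.PackingBounds.Configurations.RegularPolygonUnique

/-!
# `A(2, 2π/N) = N` with uniqueness: the regular `N`-gon is the unique optimal `N`-point code on `S¹`, every `N`

Framing: lottery ticket; floor = certified bounds/negative ranges. Venture `PackingBounds` (cell
`pub-packcert`, seat `pub-packcert-energy`) — the PACKING companion of the all-`N` universal optimality of the
regular polygons: Levenshtein's linear programming bound on the circle is sharp for every `N`, with the SAME
structural certificate (`UniversalOptimalityPolygonTable`): the top partial product
`f(t) = ω_{2m-1}(1+t) = (t - cos(2π/N)) ∏_{other nodes} (t - t_i)²` is `≤ 0` for `t ≤ cos(2π/N)`, has nonnegative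
Chebyshev coefficients (`G_nonneg`) and `f(1) = N·f₀` (design identity), so every code `C ⊂ S¹` with pairwise inner
products `≤ cos(2π/N)` has `|C| ≤ N` (`card_le`); equality forces all inner products into the node set and hence
`C` is an isometric image of the regular `N`-gon (`isometric_of_card_eq`, via `RegularPolygonUnique.isometric_of_inner_mem`).
One-statement form `code_isGreatest` (the `N`-gon attains it).

## References
* H. Cohn, A. Kumar, J. Amer. Math. Soc. 20 (2007) 99–148, Table 1 (sharp configurations are optimal codes,
  Levenshtein). [`CohnKumar2006`]
* V. I. Levenshtein, *Designs as maximum codes in polynomial metric spaces*, Acta Appl. Math. 29 (1992) 1–82. [folklore]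
-/

noncomputable section

namespace Summit.Ventures.PackingBounds.Config.RegularPolygonCode

open Finset Summit.Ventures.PackingBounds.Energy Summit.Ventures.PackingBounds.Energy.UniversalPolygon

/-- The Levenshtein polynomial of the `N`-gon: `f(t) = ω_{2m-1}(1+t) = Σ_c G_{2m-1,c} T_c(t)`. -/
private def f (N : ℕ) (t : ℝ) : ℝ := ∏ i ∈ range (N / 2 + N / 2 - 1), (1 + t - node N i)

/-- `f(t) = (t - cos(2π/N)) · (∏_{i<m-1} (1 + t - v_i))²`. -/
private theorem f_eq {N : ℕ} (hN : 2 ≤ N) (t : ℝ) :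
    f N t = (t - Real.cos (2 * Real.pi / N)) * (∏ i ∈ range (N / 2 - 1), (1 + t - node N i)) ^ 2 := by
  obtain ⟨k, hk⟩ : ∃ k, N / 2 = k + 1 := ⟨N / 2 - 1, by omega⟩
  have hadd : ∀ i, node N (k + 1 + i) = node N i := fun i => by rw [← hk]; exact node_add N i
  have hlast : 1 + t - node N k = t - Real.cos (2 * Real.pi / N) := by
    rw [node, Nat.mod_eq_of_lt (by omega), show (1 : ℝ) + t - (1 - Real.cos (psi N k)) = t - -Real.cos (psi N k) by ring,
      neg_cos_psi N k (by omega), show N / 2 - k = 1 by omega]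
    push_cast; ring_nf
  have hP : ∏ i ∈ range k, (1 + t - node N (k + 1 + i)) = ∏ i ∈ range k, (1 + t - node N i) :=
    Finset.prod_congr rfl fun i _ => by rw [hadd]
  rw [f, show N / 2 + N / 2 - 1 = (k + 1) + k by omega, Finset.prod_range_add, Finset.prod_range_succ, hP,
    show N / 2 - 1 = k by omega, hlast]
  ring

/-- `f ≤ 0` below the `N`-gon's largest inner product `cos(2π/N)`. -/
private theorem f_nonpos {N : ℕ} (hN : 2 ≤ N) {t : ℝ} (ht : t ≤ Real.cos (2 * Real.pi / N)) : f N t ≤ 0 := by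
  rw [f_eq hN]
  exact mul_nonpos_of_nonpos_of_nonneg (by linarith) (sq_nonneg _)
/-- `f` vanishes only at `cos(2π/N)` or at a node `v_i - 1`, `i < m - 1`. -/
private theorem f_eq_zero {N : ℕ} (hN : 2 ≤ N) {t : ℝ} (ht : f N t = 0) :
    t = Real.cos (2 * Real.pi / N) ∨ ∃ i < N / 2 - 1, t = node N i - 1 := by
  rw [f_eq hN] at ht
  rcases mul_eq_zero.1 ht with h | h
  · left; linarith
  · right
    obtain ⟨i, hi, h0⟩ := Finset.prod_eq_zero_iff.1 ((pow_eq_zero_iff two_ne_zero).1 h)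
    exact ⟨i, Finset.mem_range.1 hi, by linarith⟩

/-- `f(1) = N · G_{2m-1,0} > 0` (the design identity for the top partial product, which vanishes at every node). -/
private theorem f_one {N : ℕ} (hN : 2 ≤ N) : f N 1 = (N : ℝ) * G N (N / 2 + N / 2 - 1) 0 ∧ 0 < f N 1 := by
  constructor
  · rw [design hN (by omega), f]
    have hvan : ∀ i ∈ range (N / 2), mult N i * ∏ i' ∈ range (N / 2 + N / 2 - 1), (node N i - node N i') = 0 := by
      intro i hi
      have hi' := Finset.mem_range.1 hi
      rw [Finset.prod_eq_zero (i := i) (Finset.mem_range.2 (by omega)) (sub_self _), mul_zero]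
    rw [Finset.sum_eq_zero hvan, add_zero]
    exact Finset.prod_congr rfl fun i _ => by ring
  · rw [f]
    refine Finset.prod_pos fun i _ => ?_
    rw [node]
    have : -1 < Real.cos (psi N (i % (N / 2))) := by
      refine lt_of_le_of_ne (Real.neg_one_le_cos _) fun h => ?_
      have him : i % (N / 2) < N / 2 := Nat.mod_lt _ (by omega)
      have h2 := neg_cos_psi N _ him
      rw [← h] at h2
      -- `cos(2π(m - i')/N) = 1` is impossible for `0 < m - i' ≤ m`
      have hlo : 0 < 2 * Real.pi * ((N / 2 - i % (N / 2) : ℕ) : ℝ) / N := by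
        have : (0 : ℝ) < ((N / 2 - i % (N / 2) : ℕ) : ℝ) := by exact_mod_cast (show 0 < N / 2 - i % (N / 2) by omega)
        have : (0 : ℝ) < N := by exact_mod_cast (show 0 < N by omega)
        positivity
      have hhi : 2 * Real.pi * ((N / 2 - i % (N / 2) : ℕ) : ℝ) / N < 2 * Real.pi := by
        rw [div_lt_iff₀ (by exact_mod_cast (show 0 < N by omega) : (0 : ℝ) < N)]
        have : ((N / 2 - i % (N / 2) : ℕ) : ℝ) < N := by exact_mod_cast (show N / 2 - i % (N / 2) < N by omega)
        nlinarith [Real.pi_pos]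
      have := (Real.cos_eq_one_iff_of_lt_of_lt (by linarith) hhi).1 (by linarith)
      linarith
    linarith

open scoped Classical in
/-- **Levenshtein's bound on the circle, every `N`: `A(2, 2π/N) ≤ N`**, with the slackness information: every set of
unit vectors of `ℝ²` with pairwise inner products `≤ cos(2π/N)` (`N ≥ 2`) has at most `N` elements, and if it has exactly
`N` then `f` vanishes at every pairwise inner product. [cite: CohnKumar2006, Table 1] -/
theorem card_le {N : ℕ} (hN : 2 ≤ N) (C : Finset (EuclideanSpace ℝ (Fin 2))) (h1 : ∀ x ∈ C, ‖x‖ = 1)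
    (hs : ∀ x ∈ C, ∀ y ∈ C, x ≠ y → inner ℝ x y ≤ Real.cos (2 * Real.pi / N)) :
    C.card ≤ N ∧ (C.card = N → ∀ x ∈ C, ∀ y ∈ C, x ≠ y → f N (inner ℝ x y) = 0) := by
  have hNr : (0 : ℝ) < N := by exact_mod_cast (show 0 < N by omega)
  obtain ⟨hf1, hf1pos⟩ := f_one hN
  set j₀ := N / 2 + N / 2 - 1 with hj₀
  have hD : N / 2 + N / 2 = j₀ + 1 := by omega
  have hfexp : ∀ t : ℝ, f N t =
      ∑ c ∈ range (j₀ + 1), G N j₀ c * (Polynomial.Chebyshev.T ℝ c).eval t :=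
    fun t => by rw [← hD]; unfold f; exact omega_eq (N := N) (j := j₀) (by omega) t
  have hG0 : 0 < G N j₀ 0 := (mul_pos_iff_of_pos_left hNr).1 (hf1 ▸ hf1pos)
  -- lower bound: positive definiteness of the Chebyshev kernels
  have hlow : G N j₀ 0 * (C.card : ℝ) ^ 2 ≤ ∑ x ∈ C, ∑ y ∈ C, f N (inner ℝ x y) := by
    have hswap : ∑ x ∈ C, ∑ y ∈ C, f N (inner ℝ x y) =
        ∑ c ∈ range (j₀ + 1), G N j₀ c * ∑ x ∈ C, ∑ y ∈ C, (Polynomial.Chebyshev.T ℝ c).eval (inner ℝ x y) := by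
      simp_rw [hfexp, Finset.mul_sum]
      conv_rhs => rw [Finset.sum_comm]
      exact Finset.sum_congr rfl fun x _ => Finset.sum_comm
    rw [hswap, Finset.sum_range_succ']
    have h0 : ∑ x ∈ C, ∑ y ∈ C, (Polynomial.Chebyshev.T ℝ ((0 : ℕ) : ℤ)).eval (inner ℝ x y) = (C.card : ℝ) ^ 2 := by
      simp [sq]
    rw [h0]
    have hrest : 0 ≤ ∑ c ∈ range j₀,
        G N j₀ (c + 1) * ∑ x ∈ C, ∑ y ∈ C, (Polynomial.Chebyshev.T ℝ ((c + 1 : ℕ) : ℤ)).eval (inner ℝ x y) :=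
      Finset.sum_nonneg fun c _ => mul_nonneg (G_nonneg (by omega) _ _)
        (by exact_mod_cast CircleLP.sum_sum_chebyshev_nonneg C h1 (c + 1))
    linarith
  -- upper bound: diagonal `f(1)`, off-diagonal `≤ 0`
  have hterm : ∀ x ∈ C, ∀ y ∈ C.erase x, f N (inner ℝ x y) ≤ 0 := fun x hx y hy =>
    f_nonpos hN (hs x hx y (Finset.mem_of_mem_erase hy) (Finset.ne_of_mem_erase hy).symm)
  have hsplit : ∑ x ∈ C, ∑ y ∈ C, f N (inner ℝ x y) =
      (C.card : ℝ) * f N 1 + ∑ x ∈ C, ∑ y ∈ C.erase x, f N (inner ℝ x y) := by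
    rw [show (C.card : ℝ) * f N 1 = ∑ x ∈ C, f N 1 by rw [Finset.sum_const, nsmul_eq_mul], ← Finset.sum_add_distrib]
    refine Finset.sum_congr rfl fun x hx => ?_
    rw [← Finset.add_sum_erase C _ hx, real_inner_self_eq_norm_sq, h1 x hx, one_pow]
  have hoff : ∑ x ∈ C, ∑ y ∈ C.erase x, f N (inner ℝ x y) ≤ 0 :=
    Finset.sum_nonpos fun x hx => Finset.sum_nonpos fun y hy => hterm x hx y hy
  constructor
  · by_contra hlt
    push Not at hlt
    have hc : (N : ℝ) + 1 ≤ C.card := by exact_mod_cast hlt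
    rw [hsplit, hf1] at hlow
    have h2 : (C.card : ℝ) * G N j₀ 0 * C.card ≤ (C.card : ℝ) * G N j₀ 0 * N := by nlinarith [hlow, hoff]
    have h3 : (C.card : ℝ) * G N j₀ 0 * ((N : ℝ) + 1) ≤ (C.card : ℝ) * G N j₀ 0 * C.card :=
      mul_le_mul_of_nonneg_left hc (mul_nonneg (Nat.cast_nonneg _) hG0.le)
    have h4 : 0 < (C.card : ℝ) * G N j₀ 0 := mul_pos (by linarith) hG0
    nlinarith [h2, h3, h4]
  · intro hC x hx y hy hxy
    rw [hsplit, hf1, hC] at hlow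
    have hzero : ∑ x ∈ C, ∑ y ∈ C.erase x, f N (inner ℝ x y) = 0 := le_antisymm hoff (by nlinarith [hG0])
    have hx0 := (Finset.sum_eq_zero_iff_of_nonpos fun x hx => Finset.sum_nonpos fun y hy => hterm x hx y hy).1 hzero x hx
    exact (Finset.sum_eq_zero_iff_of_nonpos fun y hy => hterm x hx y hy).1 hx0 y (Finset.mem_erase.2 ⟨hxy.symm, hy⟩)

/-- **Uniqueness of the optimal code on `S¹`**: an `N`-point set of unit vectors of `ℝ²` with pairwise inner products
`≤ cos(2π/N)` is an isometric image of the regular `N`-gon. [cite: CohnKumar2006, Table 1] -/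
theorem isometric_of_card_eq {N : ℕ} (hN : 2 ≤ N) (C : Finset (EuclideanSpace ℝ (Fin 2))) (h1 : ∀ x ∈ C, ‖x‖ = 1)
    (hs : ∀ x ∈ C, ∀ y ∈ C, x ≠ y → inner ℝ x y ≤ Real.cos (2 * Real.pi / N)) (hC : C.card = N) :
    ∃ Ψ : EuclideanSpace ℝ (Fin 2) ≃ₗᵢ[ℝ] EuclideanSpace ℝ (Fin 2), C = (RegularPolygon.pts N).image Ψ := by
  refine RegularPolygonUnique.isometric_of_inner_mem hN h1 hC fun x hx y hy hxy => ?_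
  have h0 := (card_le hN C h1 hs).2 hC x hx y hy hxy
  rcases f_eq_zero hN h0 with h | ⟨i, hi, h⟩
  · right
    exact ⟨1, le_rfl, by omega, by rw [h]; push_cast; ring_nf⟩
  · right
    refine ⟨N / 2 - i, by omega, Nat.sub_le _ _, ?_⟩
    rw [h, node, Nat.mod_eq_of_lt (by omega), show (1 : ℝ) - Real.cos (psi N i) - 1 = -Real.cos (psi N i) by ring,
      neg_cos_psi N i (by omega)]

/-- The regular `N`-gon is such a code: its pairwise inner products are `≤ cos(2π/N)`. [folklore] -/
theorem pts_inner_le {N : ℕ} (hN : 2 ≤ N) :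
    ∀ x ∈ RegularPolygon.pts N, ∀ y ∈ RegularPolygon.pts N, x ≠ y → inner ℝ x y ≤ Real.cos (2 * Real.pi / N) := by
  classical
  obtain ⟨n, rfl⟩ : ∃ n, N = n + 1 := ⟨N - 1, by omega⟩
  have hNr : (0 : ℝ) < (n + 1 : ℕ) := by exact_mod_cast Nat.succ_pos n
  intro x hx y hy hxy
  obtain ⟨j, -, rfl⟩ := Finset.mem_image.1 hx
  obtain ⟨j', -, rfl⟩ := Finset.mem_image.1 hy
  have hl : j - (j - j') = j' := by abel
  rw [← hl, RegularPolygon.inner_pt_sub]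
  set l : Fin (n + 1) := j - j' with hldef
  have hl0 : l ≠ 0 := by
    intro h
    apply hxy
    rw [← hl, h, sub_zero]
  have hl1 : (1 : ℝ) ≤ (l : ℕ) := by exact_mod_cast Nat.one_le_iff_ne_zero.2 (fun h => hl0 (Fin.ext h))
  have hlN : ((l : ℕ) : ℝ) < (n + 1 : ℕ) := by exact_mod_cast l.2
  by_cases hle : 2 * ((l : ℕ) : ℝ) ≤ (n + 1 : ℕ)
  · -- `2π/N ≤ 2πl/N ≤ π`
    refine Real.cos_le_cos_of_nonneg_of_le_pi (by positivity) ?_ ?_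
    · rw [div_le_iff₀ hNr]; nlinarith [Real.pi_pos]
    · exact div_le_div_of_nonneg_right (by nlinarith [Real.pi_pos]) hNr.le
  · -- reflect: `cos(2πl/N) = cos(2π(N-l)/N)` with `1 ≤ N - l ≤ N/2`
    push Not at hle
    rw [show 2 * Real.pi * ((l : ℕ) : ℝ) / (n + 1 : ℕ) = 2 * Real.pi - 2 * Real.pi * (((n + 1 : ℕ) : ℝ) - (l : ℕ)) / (n + 1 : ℕ)
      by field_simp; ring, Real.cos_two_pi_sub]
    refine Real.cos_le_cos_of_nonneg_of_le_pi (by positivity) ?_ ?_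
    · rw [div_le_iff₀ hNr]; nlinarith [Real.pi_pos]
    · rw [div_le_div_iff_of_pos_right hNr]
      have : ((l : ℕ) : ℝ) + 1 ≤ (n + 1 : ℕ) := by exact_mod_cast l.2
      nlinarith [Real.pi_pos]

open scoped Classical in
/-- **`A(2, 2π/N) = N` for every `N ≥ 2`** (Tammes' problem on the circle / Levenshtein's bound is sharp): `N` is the
largest number of unit vectors of `ℝ²` with pairwise inner products `≤ cos(2π/N)`, attained by the regular `N`-gon;
the optimal codes are exactly its isometric images (`isometric_of_card_eq`). [cite: CohnKumar2006, Table 1] -/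
theorem code_isGreatest {N : ℕ} (hN : 2 ≤ N) :
    IsGreatest {M : ℕ | ∃ C : Finset (EuclideanSpace ℝ (Fin 2)), C.card = M ∧ (∀ x ∈ C, ‖x‖ = 1) ∧
      ∀ x ∈ C, ∀ y ∈ C, x ≠ y → inner ℝ x y ≤ Real.cos (2 * Real.pi / N)} N := by
  refine ⟨⟨RegularPolygon.pts N, RegularPolygon.card_pts N, fun _ hx => RegularPolygon.norm_of_mem_pts hx,
    pts_inner_le hN⟩, ?_⟩
  rintro M ⟨C, rfl, h1, hs⟩
  exact (card_le hN C h1 hs).1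

/-- **Any two optimal codes are isometric**: two `N`-point sets of unit vectors of `ℝ²` with pairwise inner products
`≤ cos(2π/N)` differ by an isometry of the plane. [cite: CohnKumar2006, Table 1] -/
theorem code_unique {N : ℕ} (hN : 2 ≤ N) (C C' : Finset (EuclideanSpace ℝ (Fin 2)))
    (h1 : ∀ x ∈ C, ‖x‖ = 1) (hs : ∀ x ∈ C, ∀ y ∈ C, x ≠ y → inner ℝ x y ≤ Real.cos (2 * Real.pi / N))
    (hC : C.card = N)
    (h1' : ∀ x ∈ C', ‖x‖ = 1) (hs' : ∀ x ∈ C', ∀ y ∈ C', x ≠ y → inner ℝ x y ≤ Real.cos (2 * Real.pi / N))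
    (hC' : C'.card = N) :
    ∃ Ψ : EuclideanSpace ℝ (Fin 2) ≃ₗᵢ[ℝ] EuclideanSpace ℝ (Fin 2), C' = C.image Ψ := by
  classical
  obtain ⟨Ψ, hΨ⟩ := isometric_of_card_eq hN C h1 hs hC
  obtain ⟨Ψ', hΨ'⟩ := isometric_of_card_eq hN C' h1' hs' hC'
  refine ⟨Ψ.symm.trans Ψ', ?_⟩
  rw [hΨ', hΨ, Finset.image_image]
  exact Finset.image_congr fun x _ => by simp

end Summit.Ventures.PackingBounds.Config.RegularPolygonCode

end
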